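import Summits.PneNP.PneNP.Theorems.RootDecompSegregatorSmallSegregators.Negative.KSS6
import Summits.PneNP.PneNP.Theses.RootDecompSegregator

/-!
# Refutation of `RootDecompSegregator.SmallSegregators` (stmt-PneNP-26297) — K\*\*

`SmallSegregators` (Piece A of the root-decomposition node N7, route `route-PneNP-RootDecompSegregator`,
crux rank 201) is Santhanam's segregator hypothesis (CCC 2001, the hypothesis of his Thm 2.7) typed over
the multi-pushdown step graphs `H_r(N)` (forward edges below `N` covered by the successor edges and `r`
pushdown families): for all `r k` and all large `N`, every `H_r(N)`-graph `E` has a set `J` with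
`(k+1)·|J|·(log₂ N + 1) ≤ N` outside which every vertex `v < N` has at most `N/(k+1)` `J`-avoiding
ancestors.  **It is false at `r = 3`, `k = 172`.**

WITNESS (support files `RootDecompSegregatorSmallSegregators/Negative/`: `Defs`, `KSS1` … `KSS6`): the TRIPLE-STACK
BUTTERFLY — for every `L`, the step graph `TSB.tbGraph L` on `[0, dbT L)`, `dbT L = 10·2^L·L + 2·2^L`,
is an `H_3(dbT L)`-graph (`TSB.isMultiPushdownGraph_tbGraph`, through the generic lemma
`isPushdownFamily_lifoArcs`: the push/pop matching of ANY stack trace is a pushdown family) carrying a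
charge-1 copy of the double reflected butterfly `DB(L)` (levels `0…2L` over `2^L` cells, a `K_{2,2}` per
mirror pair; `TSB.chargedDB_one : DBLayoutIn 1`).  COUNTING LEMMA `dbCount : ∀ κ, DBCount κ` (for ANY
step graph carrying a charged `DB(L)` system: the upper butterfly is a robust funnel, the lower one is
robust level by level): every `J` inside the budget leaves a step with more than `N/(12κ)` `J`-avoiding
ancestors; `ancestorRobust_of_dbLayoutIn : DBLayoutIn κ → AncestorRobust 3 (160κ) (12κ)`, whence
`ancestorRobust_three : AncestorRobust 3 160 12`, and the kill switch
`not_smallSegregatorsAt_of_ancestorRobust` at `k = c + δ = 172`.  In print: the hypothesis of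
Santhanam 2001 Thm 2.7 ("(o(n), o(n/log n)) segregators for every `H_r`") fails from three pushdowns
on — the segregator analogue of Dvir–Wigderson 2010 Cor. 5.4 (separators), one step beyond
Paul–Pippenger–Szemerédi–Trotter 1983 Thm 5.1 (which forces only `Ω(N/log N)` predecessors).

CLASS: **refuted-substantive**.  The load-bearing claim of road A of N7 (small segregators for EVERY
constant page number) is false and no cheap repair exists: (C′₁) `r ≤ 2` is true in print (Lipton–Tarjan
divisions of planar ⊇ 2-page graphs) but does not feed Santhanam's Thm 2.7, which needs every `r`;
(C′₂) the strict PPST class (pushdown graphs of on-line simulations) is still bitten — `TSB` IS three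
honest stack traces; (C′₃) Santhanam's literal budgets `(o(n), o(n/log n))` are bitten by the same
family (its robust step keeps `Θ(N)` ancestors against `|J| = Θ(N/log N)`).  barrier-candidate:
constant-page ancestor-robustness — multi-scale butterflies on three stacks defeat segregator budgets
`N/(c·log N)`; a segregator road to `DTIME(n·log n) ≠ NTIME(n·log n)` must leave `H_3`.

PROVENANCE: mathematics and Lean text by the decomp-pnenp cell's lens-1 lineage
(`decomp-pnenp-lens-1/SegregatorPageThreshold.lean` v5, sha256 `099856e2…`, theorem
`not_smallSegregators`); cone extracted and landed by the cell critic.  0 sorry; axioms `propext`,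
`Classical.choice`, `Quot.sound`.
-/

namespace Summit.PneNP.PneNP.Theorems

open RootDecompSegregatorSmallSegregators.Negative in
/-- Refutes `RootDecompSegregator.SmallSegregators` [refuted-substantive]: Santhanam's small-segregator
hypothesis for the multi-pushdown graphs `H_r(N)` fails at `r = 3`, `k = 172`; witness: the triple-stack
butterfly step graphs `TSB.tbGraph L` (three pushdown traces carrying a charged double reflected
butterfly `DB(L)`, `N = 10·2^L·L + 2·2^L`), which are ancestor-robust (`AncestorRobust 3 160 12`):
every `J` with `173·|J|·(log₂ N + 1) ≤ N` leaves a vertex with more than `N/173` `J`-avoiding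
ancestors.  No cheap repair: `r ≤ 2` is true in print but does not carry Santhanam 2001 Thm 2.7; the
strict PPST class and the literal `(o(n), o(n/log n))` budgets are bitten by the same family.
barrier-candidate: constant-page ancestor-robustness.  (decomp-pnenp lens-1 K\*\*, 2026-08-30.) -/
theorem RootDecompSegregatorSmallSegregators_refuted :
    ¬ Summit.PneNP.PneNP.Theses.RootDecompSegregator.SmallSegregators :=
  fun hS => not_smallSegregatorsAt_of_ancestorRobust ancestorRobust_three (hS 3)

end Summit.PneNP.PneNP.Theorems
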